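import Mathlib
import Summits.ValiantsHypothesis.ValiantsHypothesis.Theorems.BinomialElusiveBinomialCandidateCrossCapKernelCoefficient
import Summits.ValiantsHypothesis.ValiantsHypothesis.Theorems.BinomialElusiveBinomialCandidateInfinityStepTwoImproper

/-!
# Crux `BinomialElusive.BinomialCandidate` (stmt-ValiantsHypothesis-7392), line `registered`,
# skeleton v6 — helper `kernelPlane_coefficients` (piece B2 of `stub_nondegenerateCorankTwo`)

Four identities about a polynomial `Γ` of total degree `≤ 2` in `n + 2` variables, with quadratic
part `B = homogeneousComponent 2 Γ`, a point `y₀` and a matrix `S` with columns `s_c = S e_c`: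
the coefficients of `Y_0²`, `Y_1²`, `Y_0 Y_1` in `Γ(y₀ + S Y)` (the affine substitution
`X_j ↦ C (y₀ j) + Σ_l C (S j l) X_l`) are `B(s₀)`, `B(s₁)` and the polar form
`Σ_j (s₁)_j (∂_jB)(s₀)`, and the expansion of the quadratic form on a plane
`B(x₁κ₁ + x₂κ₂) = x₁² B(κ₁) + x₁x₂ Σ_j (κ₂)_j (∂_jB)(κ₁) + x₂² B(κ₂)`.

Proof.
* Quadratic forms (`CorankTwoKernelPlane.eval_plane_of_isHomogeneous_two`): Euler's identity
  `2 Q(v) = Σ_j v_j (∂_jQ)(v)` (Mathlib's `MvPolynomial.IsHomogeneous.sum_X_mul_pderiv`), the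
  linearity of the partial derivatives `∂_jQ` (homogeneous of degree `1`) and the symmetry of the
  polarisation (`InfinityStepTwoImproper.sum_mul_eval_pderiv_comm`).  The coefficients of a
  quadratic form are values: `coeff_{2e_i} Q = Q(e_i)`, `coeff_{e_i+e_k} Q = (∂_kQ)(e_i)`
  (`MvPolynomial.coeff_pderiv`).
* Restriction to lines (`CorankTwoKernelPlane.eval_homogeneousComponent_two_aeval`): under
  `X_l ↦ v_l X` the `X²`-coefficient of the image of a polynomial `P` is `P₂(v)`
  (`P₂ = homogeneousComponent 2 P`), and the image of `Γ(y₀ + S X)` is `Γ(y₀ + (S v) X)`, whose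
  `X²`-coefficient is `B(S v)` (`CrossCap.coeff_two_aeval_affine`).  Hence `P₂(v) = B(S v)` for
  `P = Γ(y₀ + S Y)`, and the three coefficients of `P` are read off at `v = e₀, e₁, e₀ + e₁`.
-/

-- layout Summits/ValiantsHypothesis/ValiantsHypothesis forces the duplicated namespace component
set_option linter.dupNamespace false

namespace Summit.ValiantsHypothesis.ValiantsHypothesis.Theorems.BinomialCandidateStubs

open scoped BigOperators
open MvPolynomial

namespace CorankTwoKernelPlane

/-! ## Linear and quadratic forms: values and coefficients -/

/-- A linear form is `L(z) = Σ_j z_j · coeff_{e_j} L`. -/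
theorem eval_of_isHomogeneous_one {k : ℕ} {L : MvPolynomial (Fin k) ℂ} (hL : L.IsHomogeneous 1)
    (z : Fin k → ℂ) :
    eval z L = ∑ j, z j * coeff (Finsupp.single j 1) L := by
  rw [← InfinityStepTwoImproper.sum_mul_eval_pderiv_of_isHomogeneous_one hL z 0]
  refine Finset.sum_congr rfl fun j _ => ?_
  rw [show eval (0 : Fin k → ℂ) (pderiv j L) = coeff 0 (pderiv j L) from
      DFunLike.congr_fun MvPolynomial.eval_zero _, coeff_pderiv, zero_add, Finsupp.coe_zero,
    Pi.zero_apply, Nat.cast_zero, zero_add, mul_one]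

/-- Euler's identity for a quadratic form, evaluated: `2 Q(v) = Σ_j v_j (∂_jQ)(v)`. -/
theorem two_mul_eval_of_isHomogeneous_two {k : ℕ} {Q : MvPolynomial (Fin k) ℂ}
    (hQ : Q.IsHomogeneous 2) (v : Fin k → ℂ) :
    2 * eval v Q = ∑ j, v j * eval v (pderiv j Q) := by
  have h := congrArg (eval v) hQ.sum_X_mul_pderiv
  rw [map_sum, map_nsmul, nsmul_eq_mul, Nat.cast_ofNat] at h
  rw [← h]
  exact Finset.sum_congr rfl fun j _ => by rw [map_mul, eval_X]

/-- The partial derivatives of a quadratic form are linear. -/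
theorem eval_pderiv_plane_of_isHomogeneous_two {k : ℕ} {Q : MvPolynomial (Fin k) ℂ}
    (hQ : Q.IsHomogeneous 2) (κ₁ κ₂ : Fin k → ℂ) (x₁ x₂ : ℂ) (j : Fin k) :
    eval (x₁ • κ₁ + x₂ • κ₂) (pderiv j Q) =
      x₁ * eval κ₁ (pderiv j Q) + x₂ * eval κ₂ (pderiv j Q) := by
  simp only [eval_of_isHomogeneous_one (hQ.pderiv (i := j)), Finset.mul_sum,
    ← Finset.sum_add_distrib, Pi.add_apply, Pi.smul_apply, smul_eq_mul]
  exact Finset.sum_congr rfl fun l _ => by ring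

/-- **Expansion of a quadratic form on a plane**:
`Q(x₁κ₁ + x₂κ₂) = x₁² Q(κ₁) + x₁x₂ Σ_j (κ₂)_j (∂_jQ)(κ₁) + x₂² Q(κ₂)` for `Q` homogeneous of
degree `2`. -/
theorem eval_plane_of_isHomogeneous_two {k : ℕ} {Q : MvPolynomial (Fin k) ℂ}
    (hQ : Q.IsHomogeneous 2) (κ₁ κ₂ : Fin k → ℂ) (x₁ x₂ : ℂ) :
    eval (x₁ • κ₁ + x₂ • κ₂) Q =
      x₁ ^ 2 * eval κ₁ Q + x₁ * x₂ * (∑ j, κ₂ j * eval κ₁ (pderiv j Q)) +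
        x₂ ^ 2 * eval κ₂ Q := by
  have symm := InfinityStepTwoImproper.sum_mul_eval_pderiv_comm hQ κ₁ κ₂
  refine mul_left_cancel₀ (two_ne_zero (α := ℂ)) ?_
  rw [two_mul_eval_of_isHomogeneous_two hQ]
  simp only [eval_pderiv_plane_of_isHomogeneous_two hQ, Pi.add_apply, Pi.smul_apply, smul_eq_mul]
  calc ∑ j, (x₁ * κ₁ j + x₂ * κ₂ j) * (x₁ * eval κ₁ (pderiv j Q) + x₂ * eval κ₂ (pderiv j Q))
      = x₁ ^ 2 * ∑ j, κ₁ j * eval κ₁ (pderiv j Q) +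
          x₁ * x₂ * (∑ j, κ₁ j * eval κ₂ (pderiv j Q) + ∑ j, κ₂ j * eval κ₁ (pderiv j Q)) +
          x₂ ^ 2 * ∑ j, κ₂ j * eval κ₂ (pderiv j Q) := by
        simp only [Finset.mul_sum, mul_add, ← Finset.sum_add_distrib]
        exact Finset.sum_congr rfl fun j _ => by ring
    _ = 2 * (x₁ ^ 2 * eval κ₁ Q + x₁ * x₂ * (∑ j, κ₂ j * eval κ₁ (pderiv j Q)) +
          x₂ ^ 2 * eval κ₂ Q) := by
        rw [← two_mul_eval_of_isHomogeneous_two hQ κ₁, ← two_mul_eval_of_isHomogeneous_two hQ κ₂,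
          symm]
        ring

/-- Polarisation: `Q(u + v) = Q(u) + Σ_j v_j (∂_jQ)(u) + Q(v)` for `Q` homogeneous of degree
`2`. -/
theorem eval_add_of_isHomogeneous_two {k : ℕ} {Q : MvPolynomial (Fin k) ℂ}
    (hQ : Q.IsHomogeneous 2) (u v : Fin k → ℂ) :
    eval (u + v) Q = eval u Q + (∑ j, v j * eval u (pderiv j Q)) + eval v Q := by
  have h := eval_plane_of_isHomogeneous_two hQ u v 1 1
  simp only [one_smul, one_pow, one_mul] at h
  exact h

/-- The diagonal coefficients of a quadratic form are its values at the basis vectors: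
`coeff_{2 e_i} Q = Q(e_i)`. -/
theorem coeff_single_two_of_isHomogeneous_two {k : ℕ} {Q : MvPolynomial (Fin k) ℂ}
    (hQ : Q.IsHomogeneous 2) (i : Fin k) :
    coeff (Finsupp.single i 2) Q = eval (Pi.single i 1) Q := by
  have h2 := two_mul_eval_of_isHomogeneous_two hQ (Pi.single i 1)
  rw [Finset.sum_eq_single i (fun j _ hj => by rw [Pi.single_eq_of_ne hj, zero_mul])
      (fun h => absurd (Finset.mem_univ i) h), Pi.single_eq_same, one_mul,
    eval_of_isHomogeneous_one (hQ.pderiv (i := i)),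
    Finset.sum_eq_single i (fun j _ hj => by rw [Pi.single_eq_of_ne hj, zero_mul])
      (fun h => absurd (Finset.mem_univ i) h), Pi.single_eq_same, one_mul, coeff_pderiv,
    Finsupp.single_eq_same, Nat.cast_one, one_add_one_eq_two, ← Finsupp.single_add,
    one_add_one_eq_two] at h2
  exact (mul_left_cancel₀ (two_ne_zero (α := ℂ)) (h2.trans (mul_comm _ _))).symm

/-- The off-diagonal coefficients of a quadratic form are values of its partial derivatives at
the basis vectors: `coeff_{e_i + e_l} Q = (∂_lQ)(e_i)` for `i ≠ l`. -/
theorem coeff_single_add_single_of_isHomogeneous_two {k : ℕ} {Q : MvPolynomial (Fin k) ℂ}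
    (hQ : Q.IsHomogeneous 2) {i l : Fin k} (hil : i ≠ l) :
    coeff (Finsupp.single i 1 + Finsupp.single l 1) Q = eval (Pi.single i 1) (pderiv l Q) := by
  rw [eval_of_isHomogeneous_one (hQ.pderiv (i := l)),
    Finset.sum_eq_single i (fun j _ hj => by rw [Pi.single_eq_of_ne hj, zero_mul])
      (fun h => absurd (Finset.mem_univ i) h), Pi.single_eq_same, one_mul, coeff_pderiv,
    Finsupp.single_apply, if_neg hil, Nat.cast_zero, zero_add, mul_one]

/-! ## Restriction to lines -/

/-- Under the restriction `X_l ↦ v_l X` to the line `ℂ v`, the `X^j`-coefficient of the image of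
`P` is the value at `v` of the degree-`j` homogeneous component of `P`. -/
theorem coeff_aeval_C_mul_X {σ : Type*} (P : MvPolynomial σ ℂ) (v : σ → ℂ) (j : ℕ) :
    (aeval (fun l => Polynomial.C (v l) * Polynomial.X) P).coeff j =
      eval v (homogeneousComponent j P) := by
  classical
  rw [MvPolynomial.aeval_def, MvPolynomial.eval₂_eq, Polynomial.finsetSum_coeff,
    MvPolynomial.homogeneousComponent_apply, map_sum, Finset.sum_filter]
  refine Finset.sum_congr rfl fun d _ => ?_
  have hprod : (∏ i ∈ d.support, (Polynomial.C (v i) * Polynomial.X) ^ d i) =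
      Polynomial.C (∏ i ∈ d.support, v i ^ d i) * Polynomial.X ^ d.degree := by
    rw [Finsupp.degree_apply, map_prod Polynomial.C, ← Finset.prod_pow_eq_pow_sum,
      ← Finset.prod_mul_distrib]
    exact Finset.prod_congr rfl fun i _ => by rw [mul_pow, map_pow]
  rw [← Polynomial.C_eq_algebraMap, hprod, ← mul_assoc, ← map_mul, Polynomial.coeff_C_mul_X_pow,
    MvPolynomial.eval_monomial, Finsupp.prod]
  by_cases h : d.degree = j
  · rw [if_pos h.symm, if_pos h]
  · rw [if_neg (Ne.symm h), if_neg h]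

/-- **The quadratic part of `Γ(y₀ + S Y)` is `B ∘ S`** (as functions): for `Γ` of total degree
`≤ 2`, `P = Γ(y₀_j + Σ_l S_{jl} Y_l)` and every `v`,
`(homogeneousComponent 2 P)(v) = (homogeneousComponent 2 Γ)(S v)`. -/
theorem eval_homogeneousComponent_two_aeval {m : ℕ} (Γ : MvPolynomial (Fin m) ℂ)
    (hΓ : Γ.totalDegree ≤ 2) (y₀ : Fin m → ℂ) (S : Matrix (Fin m) (Fin m) ℂ) (v : Fin m → ℂ) :
    eval v (homogeneousComponent 2
      (aeval (fun j => C (y₀ j) + ∑ l, C (S j l) * X l) Γ)) =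
      eval (fun j => ∑ l, S j l * v l) (homogeneousComponent 2 Γ) := by
  set Θ : MvPolynomial (Fin m) ℂ →ₐ[ℂ] Polynomial ℂ :=
    aeval (fun l => Polynomial.C (v l) * Polynomial.X) with hΘ
  have hφ : ∀ j, Θ (C (y₀ j) + ∑ l, C (S j l) * X l) =
      Polynomial.C (y₀ j) + Polynomial.C (∑ l, S j l * v l) * Polynomial.X := by
    intro j
    rw [map_add, map_sum, map_sum, Finset.sum_mul]
    simp only [hΘ, map_mul, MvPolynomial.aeval_C, MvPolynomial.aeval_X, Polynomial.algebraMap_eq,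
      mul_assoc]
  calc eval v (homogeneousComponent 2 (aeval (fun j => C (y₀ j) + ∑ l, C (S j l) * X l) Γ))
      = (Θ (aeval (fun j => C (y₀ j) + ∑ l, C (S j l) * X l) Γ)).coeff 2 :=
        (coeff_aeval_C_mul_X _ v 2).symm
    _ = (aeval (fun j => Θ (C (y₀ j) + ∑ l, C (S j l) * X l)) Γ).coeff 2 := by
        rw [← AlgHom.comp_apply, MvPolynomial.comp_aeval]
    _ = (aeval (fun j => Polynomial.C (y₀ j) + Polynomial.C (∑ l, S j l * v l) * Polynomial.X)
          Γ).coeff 2 := by simp_rw [hφ]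
    _ = eval (fun j => ∑ l, S j l * v l) (homogeneousComponent 2 Γ) :=
        CrossCap.coeff_two_aeval_affine Γ hΓ y₀ _

/-- The columns of `S`: `S e_c = (S j c)_j`. -/
theorem sum_mul_single {m : ℕ} (S : Matrix (Fin m) (Fin m) ℂ) (c : Fin m) :
    (fun j => ∑ l, S j l * (Pi.single c 1 : Fin m → ℂ) l) = fun j => S j c := by
  funext j
  rw [Finset.sum_eq_single c (fun l _ hl => by rw [Pi.single_eq_of_ne hl, mul_zero])
    (fun h => absurd (Finset.mem_univ c) h), Pi.single_eq_same, mul_one]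

end CorankTwoKernelPlane

open CorankTwoKernelPlane in
/-- **Helper `kernelPlane_coefficients`** (piece B2 of the stub `stub_nondegenerateCorankTwo`,
crux stmt-ValiantsHypothesis-7392, line `registered`): for `Γ` of total degree `≤ 2` with
quadratic part `B = homogeneousComponent 2 Γ`, the coefficients of `Y_0²`, `Y_1²`, `Y_0Y_1` in
`Γ(y₀_j + Σ_l S_{jl} Y_l)` are `B(s₀)`, `B(s₁)`, `Σ_j (s₁)_j (∂_jB)(s₀)` (`s_c` the columns of
`S`), and `B(x₁κ₁ + x₂κ₂) = x₁² B(κ₁) + x₁x₂ Σ_j (κ₂)_j (∂_jB)(κ₁) + x₂² B(κ₂)`. -/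
theorem kernelPlane_coefficients :
    ∀ (n : ℕ) (Γ : MvPolynomial (Fin (n + 2)) ℂ), Γ.totalDegree ≤ 2 →
      ∀ (y₀ : Fin (n + 2) → ℂ) (S : Matrix (Fin (n + 2)) (Fin (n + 2)) ℂ),
        MvPolynomial.coeff (Finsupp.single 0 2)
            (MvPolynomial.aeval (fun j => MvPolynomial.C (y₀ j) + ∑ l, MvPolynomial.C (S j l) * MvPolynomial.X l) Γ) =
          MvPolynomial.eval (fun j => S j 0) (MvPolynomial.homogeneousComponent 2 Γ) ∧
        MvPolynomial.coeff (Finsupp.single 1 2)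
            (MvPolynomial.aeval (fun j => MvPolynomial.C (y₀ j) + ∑ l, MvPolynomial.C (S j l) * MvPolynomial.X l) Γ) =
          MvPolynomial.eval (fun j => S j 1) (MvPolynomial.homogeneousComponent 2 Γ) ∧
        MvPolynomial.coeff (Finsupp.single 0 1 + Finsupp.single 1 1)
            (MvPolynomial.aeval (fun j => MvPolynomial.C (y₀ j) + ∑ l, MvPolynomial.C (S j l) * MvPolynomial.X l) Γ) =
          ∑ j, S j 1 * MvPolynomial.eval (fun l => S l 0)
            (MvPolynomial.pderiv j (MvPolynomial.homogeneousComponent 2 Γ)) ∧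
        (∀ (κ₁ κ₂ : Fin (n + 2) → ℂ) (x₁ x₂ : ℂ),
          MvPolynomial.eval (x₁ • κ₁ + x₂ • κ₂) (MvPolynomial.homogeneousComponent 2 Γ) =
            x₁ ^ 2 * MvPolynomial.eval κ₁ (MvPolynomial.homogeneousComponent 2 Γ) +
            x₁ * x₂ * (∑ j, κ₂ j * MvPolynomial.eval κ₁
              (MvPolynomial.pderiv j (MvPolynomial.homogeneousComponent 2 Γ))) +
            x₂ ^ 2 * MvPolynomial.eval κ₂ (MvPolynomial.homogeneousComponent 2 Γ)) := by
  intro n Γ hΓ y₀ S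
  set B := homogeneousComponent 2 Γ with hB
  set P := aeval (fun j => C (y₀ j) + ∑ l, C (S j l) * X l) Γ with hP
  have hB2 : B.IsHomogeneous 2 := homogeneousComponent_isHomogeneous 2 Γ
  have hP2 : (homogeneousComponent 2 P).IsHomogeneous 2 := homogeneousComponent_isHomogeneous 2 P
  -- `P₂(v) = B(S v)`
  have star : ∀ v, eval v (homogeneousComponent 2 P) = eval (fun j => ∑ l, S j l * v l) B :=
    fun v => eval_homogeneousComponent_two_aeval Γ hΓ y₀ S v
  -- the diagonal coefficients
  have sq : ∀ c : Fin (n + 2), coeff (Finsupp.single c 2) P = eval (fun j => S j c) B := by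
    intro c
    rw [show coeff (Finsupp.single c 2) P = coeff (Finsupp.single c 2) (homogeneousComponent 2 P) by
        rw [coeff_homogeneousComponent, Finsupp.degree_single, if_pos rfl],
      coeff_single_two_of_isHomogeneous_two hP2, star, sum_mul_single]
  refine ⟨sq 0, sq 1, ?_, fun κ₁ κ₂ x₁ x₂ => eval_plane_of_isHomogeneous_two hB2 κ₁ κ₂ x₁ x₂⟩
  -- the mixed coefficient
  have h01 : (0 : Fin (n + 2)) ≠ 1 := Fin.zero_ne_one' (n := n + 1)
  rw [show coeff (Finsupp.single 0 1 + Finsupp.single 1 1) P =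
        coeff (Finsupp.single 0 1 + Finsupp.single 1 1) (homogeneousComponent 2 P) by
      rw [coeff_homogeneousComponent, map_add, Finsupp.degree_single, Finsupp.degree_single,
        if_pos rfl],
    coeff_single_add_single_of_isHomogeneous_two hP2 h01]
  -- `(∂_1 P₂)(e₀) = P₂(e₀ + e₁) - P₂(e₀) - P₂(e₁) = B(s₀ + s₁) - B(s₀) - B(s₁)`
  have add := eval_add_of_isHomogeneous_two hP2 (Pi.single 0 1) (Pi.single 1 1)
  rw [Finset.sum_eq_single 1 (fun j _ hj => by rw [Pi.single_eq_of_ne hj, zero_mul])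
      (fun h => absurd (Finset.mem_univ 1) h), Pi.single_eq_same, one_mul, star, star, star,
    sum_mul_single, sum_mul_single] at add
  have e : (fun j => ∑ l, S j l *
      ((Pi.single (0 : Fin (n + 2)) (1 : ℂ) + Pi.single (1 : Fin (n + 2)) (1 : ℂ) :
        Fin (n + 2) → ℂ)) l) = (fun j => S j 0) + fun j => S j 1 := by
    rw [← sum_mul_single S 0, ← sum_mul_single S 1]
    funext j
    simp only [Pi.add_apply, mul_add, Finset.sum_add_distrib]
  rw [e, eval_add_of_isHomogeneous_two hB2] at add
  linear_combination -add

end Summit.ValiantsHypothesis.ValiantsHypothesis.Theorems.BinomialCandidateStubs
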